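import Summits.ABC.IUTFork.Thm311RealIsmDHMover
import Summits.ABC.IUTFork.Cor312TameQuadInstance
import Literature.IUT.LogVolume.AdicCompletionLogShell
import Literature.IUT.LogVolume.UnitLogNormTrace
import HarnessLib

/-!
# [IUTchIII] Thm. 3.11 (i) (Ind1), print-literal, TEAM R support: the NORM-RIGID UNIT-GROUP SHEAR at the
# tame quadratically ramified place `v₇ = (√7)` of `ℚ(√7)` — CONSTRUCTION FILE

Record file (D-0012) of the abc-iut cell (TEAM R «refutation (identified-copies reading)», lead seat
abc-iut-c312-14 = R1, gen 7); TAKES NO SIDE on [IUTchIII] Cor. 3.12.  Answer-side support for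
abc-iut-c312-1 (gen 8)'s 2026-08-26T16:41:26Z «disprover-wanted» question (R9f OPEN POINT, recorded in
`Thm311RealInd1StripLattices.lean`): «does THE units transport `β = Real.liftUnits v φ` of an ARBITRARY
`φ ∈ Aut_top(G_v)` preserve the higher unit groups `μ·U_v^{(m)}`, `m ≥ 2`?»  What the tree PROVES about
`β` is: NORM RIGIDITY (`norm_liftUnits_of_mem`, from [AbsAnab] Prop. 1.2.1 (iii)/(vi)), `β = 1` at local
degree one (`…DegOne`), `β = γ` for valuation-preserving field automorphisms (`…NonVacuity`), `β = 1` for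
inner `φ` (`liftUnits_innerAut`) — all of which PRESERVE every `μ·U_v^{(m)}`.

THIS FILE constructs, at the concrete tame quadratically ramified place `v₇` of `F₇ = ℚ(√7)` over `p = 7`
(`Cor312TameQuadInstance`, p429548), an explicit automorphism `shearEquiv` of `𝒪_{v₇}^×` — the UNIT-GROUP
SHEAR — that SATISFIES every constraint in that proved list (norm-rigid, fixes the torsion `μ` pointwise,
preserves the principal units `U^{(1)}`; the sequel file proves these) while MOVING `μ·U^{(2)}` (sequel):
so the constraint set the tree has established about `Real.liftUnits` does NOT decide c312-1's question —
any proof of the `∀`-horn must use non-abelian input beyond [AbsAnab] Prop. 1.2.1 (i)–(vii), and any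
construction of the `∃`-horn (a print-(Ind1) mover) needs exactly a `φ ∈ Aut_top(G_v)` realising this
shear on `𝒪_v^×` — the isolated lifting statement, filed in plan/GAP-LEDGER.md.

CONSTRUCTION (classical `p`-adic analysis; Neukirch ANT II (5.4)–(5.5), Koblitz Ch. IV §1–2).  In the
rescaled completion `K₇` (abc-iut-S7), `Ω := √7` satisfies `Ω² = 7`, `‖Ω‖² = 7⁻¹`; `{1, Ω}` is a
`ℚ₇`-basis (w5-d216's `IsmDHMover` toolkit); the linear SHEAR-REFLECTION
`g(a·1 + b·Ω) := a·1 + (7⁻¹a − b)·Ω` is an involution stabilising the log-ball `B(0, ‖Ω‖)`.  This file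
builds `Ω`, the basis, `g`, and the ball bookkeeping; the unit-group shear `α(u) := u·exp(g(log u) − log u)`
and its clauses are the sequel (`Thm311RealInd1UnitsShear.lean`).

[cite: NeukirchANT1999, Ch. II Prop. (5.5)] [cite: Koblitz1984, Ch. IV §1–2]
[cite: MochizukiAbsAnab2004, Prop 1.2.1 (iii) p.10] [claim: Mochizuki2012, status: disputed] for every
[IUTchIII] locution.  Consumed BY NAME, nothing restated: `Cor312TameQuadInstance` (R1, p429548),
`IsmDHMover.norm_combo`/`norm_padic_le_zpow_iff` (w5-d216, p421508), `prop12iEq_holds`/`logSeries_*`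
(abc-iut-S1), `RescaledCompletion` (abc-iut-S7), `AdicCompletionLogShell` (abc-iut-L5-t5),
`analyticLogv` (abc-iut-c312-5/c312-1).  Nothing here asserts or refutes [IUTchIII] Cor. 3.12.
-/

set_option autoImplicit false

noncomputable section

namespace Summit.ABC.IUTFork.Thm311.Real.UnitsShear

open Literature.IUT.LogVolume Literature.NumberTheory.NumberFields
open NumberField IsDedekindDomain Metric IsUltrametricDist
open Summit.ABC.IUTFork.RamifiedMover
open Summit.ABC.IUTFork.Thm311.Real

/-- `7` is prime (instance form, local to this development). [folklore] -/
instance factPrimeSeven : Fact (Nat.Prime 7) := ⟨by norm_num⟩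

/-! ## 1. The stage: the rescaled completion of `ℚ(√7)` at `v₇ = (√7)`, and `Ω = √7` -/

/-- **The rescaled completion `K₇`** of `F₇ = ℚ(√7)` at the tame quadratically ramified place
`v₇ = (√7)` over `p = 7` — a normed `ℚ₇`-algebra of dimension `2` (abc-iut-S7). [folklore] -/
abbrev K7 : Type := RescaledCompletion ↥F7 7 v7 seven_mem_v7

/-- The identity of the completion `K_{v₇}`, read as a ring isomorphism onto `K₇` (same type, same
uniform structure, rescaled norm; abc-iut-S7). [folklore] -/
def e7 : v7.adicCompletion ↥F7 ≃+* K7 := RescaledCompletion.of ↥F7 7 v7 seven_mem_v7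

/-- **`Ω := √7` in `K₇`** (the image of the generator `r7` of `F₇`). [folklore] -/
def Omega : K7 := e7 (algebraMap ↥F7 (v7.adicCompletion ↥F7) r7)

/-- `Ω² = 7` in `K₇`. [folklore] -/
theorem omega_sq : Omega ^ 2 = (7 : K7) := by
  rw [Omega, ← map_pow, ← map_pow, r7_sq, map_ofNat, map_ofNat]

/-- `Ω² = algebraMap ℚ₇ K₇ 7`. [folklore] -/
theorem omega_sq' : Omega ^ 2 = algebraMap ℚ_[7] K7 (7 : ℚ_[7]) := by
  rw [omega_sq, map_ofNat]

/-- `‖7‖ = 7⁻¹` in `ℚ₇`. [folklore] -/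
theorem norm_seven_q7 : ‖(7 : ℚ_[7])‖ = ((7 : ℕ) : ℝ)⁻¹ := by
  have h7 : (7 : ℚ_[7]) = ((7 : ℕ) : ℚ_[7]) := by norm_num
  rw [h7, Padic.norm_p]

/-- **`‖Ω‖² = 7⁻¹`** — the hypothesis `hsq` of w5-d216's `IsmDHMover` toolkit. [folklore] -/
theorem norm_omega_sq : ‖Omega‖ ^ 2 = ((7 : ℕ) : ℝ)⁻¹ := by
  have h : ‖Omega ^ 2‖ = ‖algebraMap ℚ_[7] K7 (7 : ℚ_[7])‖ := by rw [omega_sq']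
  rw [norm_pow, norm_algebraMap', norm_seven_q7] at h
  exact h

/-- `0 < ‖Ω‖ < 1`. [folklore] -/
theorem norm_omega_pos_lt_one : 0 < ‖Omega‖ ∧ ‖Omega‖ < 1 :=
  IsmDHMover.norm_pos_and_lt_one norm_omega_sq

/-- **`[K₇ : ℚ₇] = 2`** (`e = 2`, `f = 1`; w5-d216's `exists_uniformizer_sq`). [folklore] -/
theorem finrank_K7 : Module.finrank ℚ_[7] K7 = 2 :=
  (exists_uniformizer_sq 7 v7 seven_mem_v7 ramificationIdx_v7 inertiaDeg_v7).1

/-! ## 2. Coordinates: the basis `{1, Ω}` -/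

/-- **The `ℚ₇`-basis `{1, Ω}` of `K₇`** (w5-d216's parity-of-norms independence). [folklore] -/
def bs7 : Module.Basis (Fin 2) ℚ_[7] K7 :=
  haveI : FiniteDimensional ℚ_[7] K7 := Module.finite_of_finrank_eq_succ finrank_K7
  basisOfLinearIndependentOfCardEqFinrank (IsmDHMover.linearIndependent_one_varpi norm_omega_sq)
    (by rw [finrank_K7, Fintype.card_fin])

/-- `bs7 0 = 1`. [folklore] -/
theorem bs7_zero : bs7 0 = 1 := by
  have h : ⇑bs7 = ![(1 : K7), Omega] := coe_basisOfLinearIndependentOfCardEqFinrank _ _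
  rw [h]; rfl

/-- `bs7 1 = Ω`. [folklore] -/
theorem bs7_one : bs7 1 = Omega := by
  have h : ⇑bs7 = ![(1 : K7), Omega] := coe_basisOfLinearIndependentOfCardEqFinrank _ _
  rw [h]; rfl

/-- Every `x ∈ K₇` is `a·1 + b·Ω` with `a = repr x 0`, `b = repr x 1`. [folklore] -/
theorem decomp (x : K7) : x = (bs7.repr x 0) • (1 : K7) + (bs7.repr x 1) • Omega := by
  conv_lhs => rw [← bs7.sum_repr x]
  rw [Fin.sum_univ_two, bs7_zero, bs7_one]

/-- The norm on coordinates: `‖a·1 + b·Ω‖ = max(‖a‖, ‖b‖·‖Ω‖)` (w5-d216). [folklore] -/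
theorem norm_decomp (x : K7) : ‖x‖ = max ‖bs7.repr x 0‖ (‖bs7.repr x 1‖ * ‖Omega‖) := by
  conv_lhs => rw [decomp x]
  exact IsmDHMover.norm_combo norm_omega_sq _ _

/-! ## 3. The shear-reflection `g(a·1 + b·Ω) = a·1 + (7⁻¹a − b)·Ω` -/

/-- The shear coefficient `δ(x) := 7⁻¹·a − 2·b` (so `g x = x + δ(x)·Ω`). [folklore] -/
def dcoef (x : K7) : ℚ_[7] := (7 : ℚ_[7])⁻¹ * bs7.repr x 0 - 2 * bs7.repr x 1

/-- `δ` as a linear functional. [folklore] -/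
def dcoefLin : K7 →ₗ[ℚ_[7]] ℚ_[7] :=
  (7 : ℚ_[7])⁻¹ • (bs7.coord 0) - (2 : ℚ_[7]) • (bs7.coord 1)

/-- `dcoefLin` applied. [folklore] -/
theorem dcoefLin_apply (x : K7) : dcoefLin x = dcoef x := by
  simp only [dcoefLin, dcoef, LinearMap.sub_apply, LinearMap.smul_apply,
    Module.Basis.coord_apply, smul_eq_mul]

/-- **The defect map `d(x) := δ(x)·Ω`** — the difference `g − id`. [folklore] -/
def dlin : K7 →ₗ[ℚ_[7]] K7 := dcoefLin.smulRight Omega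

/-- `dlin` applied. [folklore] -/
theorem dlin_apply (x : K7) : dlin x = dcoef x • Omega := by
  rw [dlin, LinearMap.smulRight_apply, dcoefLin_apply]

/-- Coordinates of `c • Ω`: `repr 0 = 0`, `repr 1 = c`. [folklore] -/
theorem repr_smul_omega (c : ℚ_[7]) :
    bs7.repr (c • Omega) 0 = 0 ∧ bs7.repr (c • Omega) 1 = c := by
  have h : c • Omega = c • bs7 1 := by rw [bs7_one]
  rw [h, map_smul, bs7.repr_self]
  constructor <;> simp

/-- `d(d x) = −2·d x` — the defect of an involution. [folklore] -/
theorem dlin_dlin (x : K7) : dlin (dlin x) = (-2 : ℚ_[7]) • dlin x := by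
  rw [dlin_apply x, dlin_apply, dcoef, (repr_smul_omega (dcoef x)).1,
    (repr_smul_omega (dcoef x)).2, smul_smul]
  congr 1
  ring

/-- **The shear-reflection `g := id + d`**, as a linear map. [folklore] -/
def glin : K7 →ₗ[ℚ_[7]] K7 := LinearMap.id + dlin

/-- `g` applied (coefficient form). [folklore] -/
theorem glin_apply (x : K7) : glin x = x + dcoef x • Omega := by
  rw [glin, LinearMap.add_apply, LinearMap.id_apply, dlin_apply]

/-- `g = id + d` applied. [folklore] -/
theorem glin_apply' (x : K7) : glin x = x + dlin x := by
  rw [glin, LinearMap.add_apply, LinearMap.id_apply]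

/-- **`g` is an involution.** [folklore] -/
theorem glin_glin (x : K7) : glin (glin x) = x := by
  rw [glin_apply' x, glin_apply', map_add, dlin_dlin, add_assoc]
  rw [show dlin x + (dlin x + (-2 : ℚ_[7]) • dlin x) = ((1 : ℚ_[7]) + 1 + -2) • dlin x by
    rw [add_smul, add_smul, one_smul]; ring]
  norm_num

/-- `g` as a linear equivalence (involutive). [folklore] -/
def gequiv : K7 ≃ₗ[ℚ_[7]] K7 := LinearEquiv.ofInvolutive glin glin_glin

/-- `gequiv` applied. [folklore] -/
theorem gequiv_apply (x : K7) : gequiv x = glin x := rfl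

/-! ## 4. `d` and `g` stabilise the log-ball `B(0, ‖Ω‖)` -/

/-- Coordinates of a point of `B(0, ‖Ω‖)`: `‖a‖ ≤ ‖Ω‖² = 7⁻¹` (parity) and `‖b‖ ≤ 1`. [folklore] -/
theorem coords_of_mem_ball {x : K7} (hx : ‖x‖ ≤ ‖Omega‖) :
    ‖bs7.repr x 0‖ ≤ ‖Omega‖ ^ 2 ∧ ‖bs7.repr x 1‖ ≤ 1 := by
  obtain ⟨h0, _⟩ := norm_omega_pos_lt_one
  rw [norm_decomp] at hx
  obtain ⟨ha, hb⟩ := max_le_iff.mp hx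
  constructor
  · have ha' : ‖bs7.repr x 0‖ ≤ ‖Omega‖ ^ (2 * (1 : ℤ) - 1) := by
      rwa [show (2 : ℤ) * 1 - 1 = 1 by norm_num, zpow_one]
    have h := (IsmDHMover.norm_padic_le_zpow_iff norm_omega_sq _ 1).mp ha'
    rwa [show (2 : ℤ) * 1 = 2 by norm_num, show ((2 : ℤ) : ℤ) = ((2 : ℕ) : ℤ) by norm_num,
      zpow_natCast] at h
  · exact le_of_mul_le_mul_right (by rwa [one_mul]) h0

/-- `‖2‖ = 1` in `ℚ₇` (`7 ∤ 2`). [folklore] -/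
theorem norm_two_q7 : ‖(2 : ℚ_[7])‖ = 1 := by
  have h1 : ‖((2 : ℤ) : ℚ_[7])‖ ≤ 1 := Padic.norm_int_le_one 2
  have h2 : ¬ ‖((2 : ℤ) : ℚ_[7])‖ < 1 := by
    rw [Padic.norm_intCast_lt_one_iff]
    intro h
    have : (7 : ℤ) ≤ 2 := Int.le_of_dvd (by norm_num) h
    omega
  push_cast at h1 h2
  exact le_antisymm h1 (not_lt.mp h2)

/-- `‖7‖ = ‖Ω‖²` in `ℚ₇` (the scalar norm of the prime). [folklore] -/
theorem norm_seven_eq_sq : ‖(7 : ℚ_[7])‖ = ‖Omega‖ ^ 2 := by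
  rw [norm_seven_q7, norm_omega_sq]

/-- **`‖d x‖ ≤ ‖Ω‖` on the log-ball**: the defect stays in the ball. [folklore] -/
theorem norm_dlin_le {x : K7} (hx : ‖x‖ ≤ ‖Omega‖) : ‖dlin x‖ ≤ ‖Omega‖ := by
  obtain ⟨h0, _⟩ := norm_omega_pos_lt_one
  obtain ⟨ha, hb⟩ := coords_of_mem_ball hx
  rw [dlin_apply, norm_smul]
  have hd : ‖dcoef x‖ ≤ 1 := by
    rw [dcoef, sub_eq_add_neg]
    refine (norm_add_le_max _ _).trans (max_le ?_ ?_)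
    · rw [norm_mul, norm_inv, norm_seven_eq_sq]
      calc (‖Omega‖ ^ 2)⁻¹ * ‖bs7.repr x 0‖ ≤ (‖Omega‖ ^ 2)⁻¹ * ‖Omega‖ ^ 2 := by gcongr
        _ = 1 := inv_mul_cancel₀ (by positivity)
    · rw [norm_neg, norm_mul, norm_two_q7, one_mul]
      exact hb
  calc ‖dcoef x‖ * ‖Omega‖ ≤ 1 * ‖Omega‖ := by gcongr
    _ = ‖Omega‖ := one_mul _

/-- `g` stabilises the log-ball. [folklore] -/
theorem norm_glin_le {x : K7} (hx : ‖x‖ ≤ ‖Omega‖) : ‖glin x‖ ≤ ‖Omega‖ := by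
  rw [glin_apply' x]
  exact (norm_add_le_max _ _).trans (max_le hx (norm_dlin_le hx))

end Summit.ABC.IUTFork.Thm311.Real.UnitsShear

end
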